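import Literature.MathematicalPhysics.QuantumLattice.GrassmannGramBoundedLineExtraction
import Literature.MathematicalPhysics.QuantumLattice.GrassmannEffectiveActionBlocks
import Literature.MathematicalPhysics.QuantumLattice.GrassmannLinearSubstitution
import Literature.MathematicalPhysics.QuantumLattice.GrassmannLaplacianGramBound
import Literature.MathematicalPhysics.QuantumLattice.GrassmannChargeScaling
import Literature.MathematicalPhysics.QuantumLattice.GrassmannEffectiveActionCopies
import HarnessLib

/-!
# Gram-boundedness is ADDITIVE at property level: `IsGramBounded A κ_A → IsGramBounded B κ_B → IsGramBounded (A + B) (κ_A + κ_B)`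

Topic `MathematicalPhysics/QuantumLattice`; companion of `GrassmannDeterminantBounded` (`IsGramBounded(R)`) and `GrassmannGramBoundedWeights`.  For Gram
FORMS the sum of two covariances is a form on the direct sum (`GrassmannGramFormAlgebra`); here the same for the PROPERTY `‖∫ dμ_C ψ(Z)‖ ≤ κ^{|Z|}`
(determinant bounds à la Pedra–Salmhofer carry no vectors).  Proof = DOUBLING (Salmhofer 1999, §2.5 (2.105) / §4.3 (4.84): a field of covariance `A + B`
is the sum of two INDEPENDENT fields; Benfatto–Giuliani–Mastropietro 2006, (2.12), (2.80)): with the block covariance `A ⊕ B` on two copies of the labels,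
`∫ dμ_{A+B} ψ(Z) = Σ_{colourings c} ∫ dμ_{A⊕B} Π_i ψ_{c_i}(Z_i)` (`gaussConv_fieldSum`); each coloured string factorises — after sorting the copies (a sign) —
into `∫dμ_A (copy-0 legs) · ∫dμ_B (copy-1 legs)` (independence for strings of ANY parity, `gaussConv_mul_of_blockDiag'`), and
`Σ_c κ_A^{#c⁻¹(0)} κ_B^{#c⁻¹(1)} = (κ_A + κ_B)^N`.  Main results: **`norm_gaussExpect_genProd_add_le`**, **`IsGramBounded.add`**, **`IsGramBoundedR.add`**;
over `ℂ` (substitution `ψ ↦ iψ`): `norm_gaussExpect_genProd_neg`, **`IsGramBoundedR.neg`**, **`IsGramBoundedR.sub`**.  Everything is proved; no definition.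

## Sources
M. Salmhofer, *Renormalization: An Introduction* (Springer 1999), §2.5 (2.105), §4.3 (4.84) [`Salmhofer1999`]; G. Benfatto, A. Giuliani, V. Mastropietro,
Ann. Henri Poincaré 7 (2006) 809–898, (2.12), (2.80) [`BenfattoGiulianiMastropietro2006`]; W. de Siqueira Pedra, M. Salmhofer, Comm. Math. Phys. 282 (2008)
797–818, Thm 1.3 [`PedraSalmhofer2008`].
-/

noncomputable section

namespace Literature.MathematicalPhysics.QuantumLattice

open GrassmannAlgebra Finset
open scoped InnerProductSpace

universe u

/-! ### §1 Independence of decoupled blocks for factors of any parity -/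

section Blocks

variable (R : Type*) [CommRing R] [Algebra ℚ R] {Γ : Type*} [Fintype Γ] [DecidableEq Γ]

omit [Algebra ℚ R] [Fintype Γ] in
/-- `∂_X ∂_Y (a b) = a ∂_X ∂_Y b` for `a` of ANY parity supported on labels `S ∌ X, Y` (the two signs of the graded Leibniz rule cancel:
`invol ∘ invol = id`). [cite: Salmhofer1999, §4.3 (4.86)] -/
theorem grassmannDeriv_grassmannDeriv_mul_of_mem {S : Set Γ} {X Y : Γ} (hX : X ∉ S) (hY : Y ∉ S) {a : GrassmannAlgebra R Γ}
    (ha : a ∈ fieldSubalgebra R S) (b : GrassmannAlgebra R Γ) :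
    grassmannDeriv R X (grassmannDeriv R Y (a * b)) = a * grassmannDeriv R X (grassmannDeriv R Y b) := by
  rw [grassmannDeriv_mul, grassmannDeriv_eq_zero_of_mem_fieldSubalgebra R hY ha, zero_mul, zero_add, grassmannDeriv_mul,
    grassmannDeriv_eq_zero_of_mem_fieldSubalgebra R hX (involute_mem_fieldSubalgebra R ha), zero_mul, zero_add,
    CliffordAlgebra.involute_involute]

/-- **`Δ_{C'} (a b) = a Δ_{C'} b`** for `a` of ANY parity supported on `S`, `C'` charging no label of `S` (parity-free form of
`GrassmannPairLaplacians.grassmannLaplacian_mul_eq_mul_of_mem`). [cite: Salmhofer1999, §4.3 (4.86)] -/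
theorem grassmannLaplacian_mul_eq_mul_of_mem' (C' : Matrix Γ Γ R) {S : Set Γ}
    (hC : ∀ X Y, X ∈ S ∨ Y ∈ S → C' X Y = 0) {a : GrassmannAlgebra R Γ} (ha : a ∈ fieldSubalgebra R S) (b : GrassmannAlgebra R Γ) :
    grassmannLaplacian R C' (a * b) = a * grassmannLaplacian R C' b := by
  rw [grassmannLaplacian_apply, grassmannLaplacian_apply, mul_smul_comm, Finset.mul_sum]
  congr 1
  refine Finset.sum_congr rfl fun X _ => ?_
  rw [Finset.mul_sum]
  refine Finset.sum_congr rfl fun Y _ => ?_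
  by_cases hXY : X ∈ S ∨ Y ∈ S
  · rw [hC X Y hXY, zero_smul, zero_smul, mul_zero]
  · push Not at hXY
    rw [grassmannDeriv_grassmannDeriv_mul_of_mem R hXY.1 hXY.2 ha, mul_smul_comm]

/-- **Independence of decoupled blocks, factors of ANY parity**: if `C` does not couple `S` to `Sᶜ`, then for `a` supported on `S` and `b` on `Sᶜ`,
`μ_C ⋆ (a b) = (μ_C ⋆ a)(μ_C ⋆ b)`. [cite: Salmhofer1999, §4.3 (4.84)] -/
theorem gaussConv_mul_of_blockDiag' {S : Set Γ} (C : Matrix Γ Γ R)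
    (hC₁ : ∀ X Y, X ∈ S → Y ∉ S → C X Y = 0) (hC₂ : ∀ X Y, X ∉ S → Y ∈ S → C X Y = 0)
    {a b : GrassmannAlgebra R Γ} (ha : a ∈ fieldSubalgebra R S) (hb : b ∈ fieldSubalgebra R Sᶜ) :
    gaussConv R C (a * b) = gaussConv R C a * gaussConv R C b := by
  classical
  set Cin : Matrix Γ Γ R := Matrix.of fun X Y => if X ∈ S then C X Y else 0 with hCin
  set Cout : Matrix Γ Γ R := Matrix.of fun X Y => if X ∈ S then 0 else C X Y with hCout
  have hsplit : C = Cin + Cout := by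
    ext X Y
    simp only [hCin, hCout, Matrix.add_apply, Matrix.of_apply]
    split_ifs <;> simp
  have hin : ∀ X Y, X ∈ Sᶜ ∨ Y ∈ Sᶜ → Cin X Y = 0 := by
    intro X Y hXY
    simp only [hCin, Matrix.of_apply]
    split_ifs with hX
    · exact hXY.elim (fun hX' => absurd hX hX') (fun hY' => hC₁ X Y hX hY')
    · rfl
  have hout : ∀ X Y, X ∈ S ∨ Y ∈ S → Cout X Y = 0 := by
    intro X Y hXY
    simp only [hCout, Matrix.of_apply]
    split_ifs with hX
    · rfl
    · exact hXY.elim (fun hX' => absurd hX' hX) (fun hY' => hC₂ X Y hX hY')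
  have hin0 : ∀ X Y, X ∈ Sᶜ → Y ∈ Sᶜ → Cin X Y = 0 := fun X Y hX _ => hin X Y (Or.inl hX)
  have hout0 : ∀ X Y, X ∈ S → Y ∈ S → Cout X Y = 0 := fun X Y hX _ => hout X Y (Or.inl hX)
  have gC : ∀ F, gaussConv R C F = gaussConv R Cin (gaussConv R Cout F) := fun F => by
    rw [hsplit]; exact gaussConv_add_apply R Cin Cout F
  have e1 : ∀ y, gaussConv R Cout (a * y) = a * gaussConv R Cout y := fun y => by
    rw [gaussConv_def]
    exact exp_apply_mul_left R (isNilpotent_grassmannLaplacian R Cout)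
      (fun z => grassmannLaplacian_mul_eq_mul_of_mem' R Cout hout ha z) y
  have e2 : ∀ {b' : GrassmannAlgebra R Γ}, b' ∈ fieldSubalgebra R Sᶜ → ∀ y, gaussConv R Cin (y * b') = gaussConv R Cin y * b' :=
    fun hb' y => by
      rw [gaussConv_def]
      exact exp_apply_mul_right R (isNilpotent_grassmannLaplacian R Cin)
        (fun z => grassmannLaplacian_mul_eq_mul_of_mem_right R Cin hin z hb') y
  have e3 : gaussConv R Cout a = a := by
    rw [gaussConv_def]
    exact exp_apply_eq_self_of_apply_eq_zero R (isNilpotent_grassmannLaplacian R Cout) (grassmannLaplacian_eq_zero_of_mem R Cout hout0 ha)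
  have hb'' : gaussConv R Cout b ∈ fieldSubalgebra R Sᶜ := gaussConv_mem_fieldSubalgebra R Cout hb
  have e4 : gaussConv R Cin (gaussConv R Cout b) = gaussConv R Cout b := by
    rw [gaussConv_def R Cin]
    exact exp_apply_eq_self_of_apply_eq_zero R (isNilpotent_grassmannLaplacian R Cin) (grassmannLaplacian_eq_zero_of_mem R Cin hin0 hb'')
  calc gaussConv R C (a * b) = gaussConv R Cin (gaussConv R Cout (a * b)) := gC _
    _ = gaussConv R Cin (a * gaussConv R Cout b) := by rw [e1]
    _ = gaussConv R Cin a * gaussConv R Cout b := e2 hb'' a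
    _ = gaussConv R C a * gaussConv R C b := by rw [gC a, e3, gC b, e4]

/-- **Independent fields integrate separately**: `∫ dμ_C (a b) = ∫ dμ_C a · ∫ dμ_C b` for `a` on `S`, `b` on `Sᶜ`, `C` not coupling them
(any parities). [cite: Salmhofer1999, §4.3 (4.84)] -/
theorem gaussExpect_mul_of_blockDiag {S : Set Γ} (C : Matrix Γ Γ R)
    (hC₁ : ∀ X Y, X ∈ S → Y ∉ S → C X Y = 0) (hC₂ : ∀ X Y, X ∉ S → Y ∈ S → C X Y = 0)
    {a b : GrassmannAlgebra R Γ} (ha : a ∈ fieldSubalgebra R S) (hb : b ∈ fieldSubalgebra R Sᶜ) :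
    gaussExpect R C (a * b) = gaussExpect R C a * gaussExpect R C b := by
  rw [gaussExpect_apply, gaussExpect_apply, gaussExpect_apply, gaussConv_mul_of_blockDiag' R C hC₁ hC₂ ha hb, map_mul]

end Blocks

/-! ### §2 The doubling identity `∫ dμ_{A+B} ψ(Z) = Σ_c ∫ dμ_{A⊕B} Π ψ_{c_i}(Z_i)` -/

section Doubling

variable (R : Type*) [CommRing R] [Algebra ℚ R] {Γ : Type*} [Fintype Γ] [DecidableEq Γ] {S : Type*} [Fintype S] [DecidableEq S]

omit [Algebra ℚ R] in
/-- **A string under the field-sum substitution**: `ψ(Z₁)⋯ψ(Z_N) ∘ (ψ ↦ Σ_s ψ_s) = Σ_{c : Fin N → S} ψ_{c₁}(Z₁)⋯ψ_{c_N}(Z_N)`.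
[cite: Salmhofer1999, §2.5 (2.105)] -/
theorem map_funLeft_fst_genProd {N : ℕ} (Z : Fin N → Γ) :
    ExteriorAlgebra.map (LinearMap.funLeft R R (Prod.fst : Γ × S → Γ)) (genProd R Z) =
      ∑ c : Fin N → S, genProd R (fun i => (Z i, c i)) := by
  induction N with
  | zero =>
    rw [Fintype.sum_unique]
    simp [genProd]
  | succ N ih =>
    rw [genProd_succ, map_mul, map_funLeft_fst_gen, ih (Fin.tail Z), Finset.sum_mul]
    simp_rw [Finset.mul_sum]
    rw [← (Fin.consEquiv fun _ : Fin (N + 1) => S).sum_comp, Fintype.sum_prod_type]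
    refine Finset.sum_congr rfl fun s _ => Finset.sum_congr rfl fun c _ => ?_
    rw [genProd_succ]
    simp only [Fin.consEquiv, Equiv.coe_fn_mk, Fin.cons_zero]
    congr 2

/-- **The doubling identity**: for a covariance `C'` of the copies `Γ × S` whose copies' sum is `Σ_{s,s'} C'_{ss'}`,
`∫ dμ_{Σ C'} ψ(Z) = Σ_c ∫ dμ_{C'} Π_i ψ_{c_i}(Z_i)`. [cite: Salmhofer1999, §2.5 (2.105)] -/
theorem gaussExpect_fieldSum_genProd_eq_sum (C' : Matrix (Γ × S) (Γ × S) R) {N : ℕ} (Z : Fin N → Γ) :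
    gaussExpect R (Matrix.of fun X Y => ∑ s, ∑ s', C' (X, s) (Y, s')) (genProd R Z) =
      ∑ c : Fin N → S, gaussExpect R C' (genProd R (fun i => (Z i, c i))) := by
  have h := gaussConv_fieldSum R C' (genProd R Z)
  rw [map_funLeft_fst_genProd, map_sum] at h
  have h2 := congrArg (constPart R) h
  rw [constPart_map, map_sum] at h2
  rw [gaussExpect_apply, ← h2]
  simp_rw [gaussExpect_apply]

end Doubling

/-! ### §3 Additivity of the Gram bound -/

section Add

variable {𝕜 : Type*} [RCLike 𝕜] {Γ : Type u} [Fintype Γ] [DecidableEq Γ]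

/-- The copy embedding `ψ(X) ↦ ψ(X, t)` maps a string to the same string in copy `t`. [cite: Salmhofer1999, §2.5 (2.105)] -/
theorem map_copyEmb_genProd {T : Type*} [Fintype T] [DecidableEq T] (t : T) {m : ℕ} (Y : Fin m → Γ) :
    ExteriorAlgebra.map (LinearMap.pi (fun X' : Γ × T => if X'.2 = t then (LinearMap.proj X'.1 : (Γ → 𝕜) →ₗ[𝕜] 𝕜) else 0))
        (genProd 𝕜 Y) = genProd 𝕜 (fun i => (Y i, t)) := by
  have hf : ∀ (v : Γ → 𝕜) (X' : Γ × T),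
      LinearMap.pi (fun X' : Γ × T => if X'.2 = t then (LinearMap.proj X'.1 : (Γ → 𝕜) →ₗ[𝕜] 𝕜) else 0) v X' =
        if ((Equiv.prodComm Γ T) X').1 = t then v ((Equiv.prodComm Γ T) X').2 else 0 := by
    intro v X'
    rw [LinearMap.pi_apply]
    simp only [Equiv.prodComm_apply, Prod.fst_swap, Prod.snd_swap]
    split_ifs <;> rfl
  induction m with
  | zero => simp [genProd]
  | succ m ih =>
    rw [genProd_succ, map_mul, map_blockEmb_gen (Equiv.prodComm Γ T) hf, ih (Fin.tail Y), genProd_succ]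
    rfl

/-- The copy embedding pulls the two-copy block covariance `[s = s']·(s = 0 ? A : B)` back to `A` (copy `0`) resp. `B` (copy `1`).
[cite: Salmhofer1999, §2.5 (2.105)] -/
theorem transpose_mul_twoCopy_mul_copyEmb (A B : Matrix Γ Γ 𝕜) (t : Fin 2) :
    (LinearMap.toMatrix' (LinearMap.pi (fun X' : Γ × Fin 2 => if X'.2 = t then (LinearMap.proj X'.1 : (Γ → 𝕜) →ₗ[𝕜] 𝕜) else 0))).transpose *
        (Matrix.of fun X Y : Γ × Fin 2 => if X.2 = Y.2 then (if X.2 = 0 then A X.1 Y.1 else B X.1 Y.1) else 0) *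
        LinearMap.toMatrix' (LinearMap.pi (fun X' : Γ × Fin 2 => if X'.2 = t then (LinearMap.proj X'.1 : (Γ → 𝕜) →ₗ[𝕜] 𝕜) else 0)) =
      if t = 0 then A else B := by
  have hf : ∀ (v : Γ → 𝕜) (X' : Γ × Fin 2),
      LinearMap.pi (fun X' : Γ × Fin 2 => if X'.2 = t then (LinearMap.proj X'.1 : (Γ → 𝕜) →ₗ[𝕜] 𝕜) else 0) v X' =
        if ((Equiv.prodComm Γ (Fin 2)) X').1 = t then v ((Equiv.prodComm Γ (Fin 2)) X').2 else 0 := by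
    intro v X'
    rw [LinearMap.pi_apply]
    simp only [Equiv.prodComm_apply, Prod.fst_swap, Prod.snd_swap]
    split_ifs <;> rfl
  have hM : ∀ (X' : Γ × Fin 2) (X : Γ),
      LinearMap.toMatrix' (LinearMap.pi (fun X' : Γ × Fin 2 => if X'.2 = t then (LinearMap.proj X'.1 : (Γ → 𝕜) →ₗ[𝕜] 𝕜) else 0)) X' X =
        if X' = (X, t) then 1 else 0 := by
    intro X' X
    rw [toMatrix'_blockEmb (Equiv.prodComm Γ (Fin 2)) hf]
    by_cases h : X' = (X, t)
    · rw [if_pos h, if_pos (by rw [h]; rfl)]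
    · rw [if_neg h, if_neg (fun h' => h (Prod.ext (Prod.ext_iff.1 h').2 (Prod.ext_iff.1 h').1))]
  ext X Y
  simp only [Matrix.mul_apply, Matrix.transpose_apply, hM, Matrix.of_apply]
  rw [Finset.sum_eq_single (Y, t)]
  · rw [if_pos rfl, mul_one, Finset.sum_eq_single (X, t)]
    · rw [if_pos rfl, one_mul, if_pos rfl]
      split_ifs <;> rfl
    · intro X' _ hX'
      rw [if_neg hX', zero_mul]
    · exact fun h => (h (mem_univ _)).elim
  · intro Y' _ hY'
    rw [if_neg hY', mul_zero]
  · exact fun h => (h (mem_univ _)).elim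

/-- A string of copy `t` integrates against the two-copy block covariance as against `A` (`t = 0`) or `B` (`t = 1`).
[cite: Salmhofer1999, §4.3 (4.84)] -/
theorem gaussExpect_twoCopy_genProd (A B : Matrix Γ Γ 𝕜) (t : Fin 2) {m : ℕ} (Y : Fin m → Γ) :
    gaussExpect 𝕜 (Matrix.of fun X Y : Γ × Fin 2 => if X.2 = Y.2 then (if X.2 = 0 then A X.1 Y.1 else B X.1 Y.1) else 0)
        (genProd 𝕜 (fun i => (Y i, t))) = gaussExpect 𝕜 (if t = 0 then A else B) (genProd 𝕜 Y) := by
  rw [← map_copyEmb_genProd t Y, gaussExpect_apply, gaussConv_map, transpose_mul_twoCopy_mul_copyEmb, constPart_map, gaussExpect_apply]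

/-- **THE STRING BOUND FOR `A + B`**: if every string has `|∫dμ_A ψ(Z)| ≤ κ_A^{|Z|}` and `|∫dμ_B ψ(Z)| ≤ κ_B^{|Z|}` (`κ_A ≥ 0`), then
`|∫dμ_{A+B} ψ(Z)| ≤ (κ_A + κ_B)^{|Z|}` (doubling + independence + binomial count). [cite: BenfattoGiulianiMastropietro2006, (2.80)] -/
theorem norm_gaussExpect_genProd_add_le (A B : Matrix Γ Γ 𝕜) {κA κB : ℝ} (hκA : 0 ≤ κA)
    (hA : ∀ (m : ℕ) (Y : Fin m → Γ), ‖gaussExpect 𝕜 A (genProd 𝕜 Y)‖ ≤ κA ^ m)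
    (hB : ∀ (m : ℕ) (Y : Fin m → Γ), ‖gaussExpect 𝕜 B (genProd 𝕜 Y)‖ ≤ κB ^ m) {N : ℕ} (Z : Fin N → Γ) :
    ‖gaussExpect 𝕜 (A + B) (genProd 𝕜 Z)‖ ≤ (κA + κB) ^ N := by
  classical
  -- the two-copy block covariance and the doubling identity
  set C' : Matrix (Γ × Fin 2) (Γ × Fin 2) 𝕜 :=
    Matrix.of fun X Y : Γ × Fin 2 => if X.2 = Y.2 then (if X.2 = 0 then A X.1 Y.1 else B X.1 Y.1) else 0 with hC'
  have hsum : (Matrix.of fun X Y : Γ => ∑ s : Fin 2, ∑ s' : Fin 2, C' (X, s) (Y, s')) = A + B := by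
    ext X Y
    simp [hC', Fin.sum_univ_two, Matrix.add_apply]
  rw [← hsum, gaussExpect_fieldSum_genProd_eq_sum]
  -- bound per colouring
  have hcol : ∀ c : Fin N → Fin 2, ‖gaussExpect 𝕜 C' (genProd 𝕜 (fun i => (Z i, c i)))‖ ≤
      ∏ i, (if c i = 0 then κA else κB) := by
    intro c
    -- sort the coloured string: copy-0 legs first
    set p : Fin N → Prop := fun i => c i = 0 with hp
    set a := (univ.filter fun i => p i).card with ha
    set b := (univ.filter fun i => ¬ p i).card with hb
    have hN : a + b = N := by rw [ha, hb, card_filter_add_card_filter_not, card_univ, Fintype.card_fin]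
    have hca : Fintype.card {i // p i} = a := by rw [Fintype.card_subtype]
    have hcb : Fintype.card {i // ¬ p i} = b := by rw [Fintype.card_subtype]
    set e₁ : {i // p i} ≃ Fin a := Fintype.equivFinOfCardEq hca with he₁
    set e₂ : {i // ¬ p i} ≃ Fin b := Fintype.equivFinOfCardEq hcb with he₂
    set Wa : Fin a → Γ × Fin 2 := fun i => (Z (e₁.symm i), c (e₁.symm i)) with hWa
    set Wb : Fin b → Γ × Fin 2 := fun j => (Z (e₂.symm j), c (e₂.symm j)) with hWb
    set σ : Fin N ≃ Fin a ⊕ Fin b := (Equiv.sumCompl p).symm.trans (e₁.sumCongr e₂) with hσ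
    set ρ : Equiv.Perm (Fin N) := (σ.trans finSumFinEquiv).trans (finCongr hN) with hρ
    have hZ : (fun i => (Z i, c i)) = (Fin.append Wa Wb ∘ (finCongr hN).symm) ∘ ρ := by
      have hsymm : ∀ x : Fin a ⊕ Fin b, (Z (σ.symm x), c (σ.symm x)) = Fin.append Wa Wb (finSumFinEquiv x) := by
        rintro (i | j)
        · rw [finSumFinEquiv_apply_left, Fin.append_left, hσ, Equiv.symm_trans_apply, Equiv.symm_symm,
            Equiv.sumCongr_symm, Equiv.sumCongr_apply, Sum.map_inl, Equiv.sumCompl_apply_inl]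
        · rw [finSumFinEquiv_apply_right, Fin.append_right, hσ, Equiv.symm_trans_apply, Equiv.symm_symm,
            Equiv.sumCongr_symm, Equiv.sumCongr_apply, Sum.map_inr, Equiv.sumCompl_apply_inr]
      funext i
      have h := hsymm (σ i)
      rw [Equiv.symm_apply_apply] at h
      rw [h, hρ]
      simp only [Function.comp_apply, Equiv.trans_apply, Equiv.symm_apply_apply]
    -- the copy-0 string is the embedded string `Z ∘ e₁⁻¹` in copy 0, the rest in copy 1
    have hWa : Wa = fun i => (Z (e₁.symm i), (0 : Fin 2)) := by
      funext i; rw [hWa]; exact Prod.ext rfl (e₁.symm i).2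
    have hWb : Wb = fun j => (Z (e₂.symm j), (1 : Fin 2)) := by
      funext j
      have h2 : c (e₂.symm j) ≠ 0 := (e₂.symm j).2
      have h3 : c (e₂.symm j) = 1 := by
        rcases Fin.eq_zero_or_eq_succ (n := 1) (c (e₂.symm j)) with h0 | ⟨k, hk⟩
        · exact absurd h0 h2
        · rw [hk, Fin.eq_zero k]; rfl
      rw [hWb]
      exact Prod.ext rfl h3
    -- independence
    have hSa : genProd 𝕜 Wa ∈ fieldSubalgebra 𝕜 {X : Γ × Fin 2 | X.2 = 0} :=
      fieldSubalgebra_mono 𝕜 (by rintro _ ⟨i, rfl⟩; rw [hWa]; rfl) (genProd_mem_fieldSubalgebra_range 𝕜 Wa)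
    have hSb : genProd 𝕜 Wb ∈ fieldSubalgebra 𝕜 {X : Γ × Fin 2 | X.2 = 0}ᶜ :=
      fieldSubalgebra_mono 𝕜 (by
        rintro _ ⟨j, rfl⟩
        rw [hWb]
        simp) (genProd_mem_fieldSubalgebra_range 𝕜 Wb)
    have hC₁ : ∀ X Y : Γ × Fin 2, X ∈ {X : Γ × Fin 2 | X.2 = 0} → Y ∉ {X : Γ × Fin 2 | X.2 = 0} → C' X Y = 0 := by
      intro X Y hX hY
      simp only [Set.mem_setOf_eq] at hX hY
      rw [hC', Matrix.of_apply, if_neg (by rw [hX]; exact Ne.symm hY)]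
    have hC₂ : ∀ X Y : Γ × Fin 2, X ∉ {X : Γ × Fin 2 | X.2 = 0} → Y ∈ {X : Γ × Fin 2 | X.2 = 0} → C' X Y = 0 := by
      intro X Y hX hY
      simp only [Set.mem_setOf_eq] at hX hY
      rw [hC', Matrix.of_apply, if_neg (by rw [hY]; exact hX)]
    rw [hZ, genProd_comp_perm, map_smul, finCongr_symm, genProd_comp_finCongr, genProd_append,
      gaussExpect_mul_of_blockDiag 𝕜 C' hC₁ hC₂ hSa hSb, smul_eq_mul, norm_intCast_units_smul, norm_mul, hWa, hWb,
      gaussExpect_twoCopy_genProd, gaussExpect_twoCopy_genProd, if_pos rfl, if_neg (by decide)]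
    -- the two factors
    have h1 : ‖gaussExpect 𝕜 A (genProd 𝕜 fun i => Z (e₁.symm i))‖ ≤ κA ^ a := hA a _
    have h2 : ‖gaussExpect 𝕜 B (genProd 𝕜 fun j => Z (e₂.symm j))‖ ≤ κB ^ b := hB b _
    have hprod : ∏ i, (if c i = 0 then κA else κB) = κA ^ a * κB ^ b := by
      rw [Finset.prod_ite, prod_const, prod_const]
    rw [hprod]
    exact mul_le_mul h1 h2 (norm_nonneg _) (pow_nonneg hκA _)
  -- binomial count
  calc ‖∑ c : Fin N → Fin 2, gaussExpect 𝕜 C' (genProd 𝕜 fun i => (Z i, c i))‖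
      ≤ ∑ c : Fin N → Fin 2, ‖gaussExpect 𝕜 C' (genProd 𝕜 fun i => (Z i, c i))‖ := norm_sum_le _ _
    _ ≤ ∑ c : Fin N → Fin 2, ∏ i, (if c i = 0 then κA else κB) := sum_le_sum fun c _ => hcol c
    _ = (κA + κB) ^ N := by
        rw [← Fintype.piFinset_univ, ← Finset.prod_univ_sum (fun _ : Fin N => (univ : Finset (Fin 2))) (fun _ s => if s = 0 then κA else κB),
          prod_const, card_univ, Fintype.card_fin, Fin.sum_univ_two, if_pos rfl, if_neg (by decide)]

/-- **GRAM-BOUNDEDNESS IS ADDITIVE (property level)**: `IsGramBounded A κ_A → IsGramBounded B κ_B → IsGramBounded (A + B) (κ_A + κ_B)`.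
[cite: BenfattoGiulianiMastropietro2006, (2.80)] -/
theorem IsGramBounded.add {A B : Matrix Γ Γ 𝕜} {κA κB : ℝ} (hA : IsGramBounded A κA) (hB : IsGramBounded B κB)
    (hκA : 0 ≤ κA) : IsGramBounded (A + B) (κA + κB) := by
  intro n U hU N Z
  have h : gramWeighted U (A + B) = gramWeighted U A + gramWeighted U B := by
    ext X Y
    simp [gramWeighted_apply, Matrix.add_apply, mul_add]
  rw [h]
  exact norm_gaussExpect_genProd_add_le _ _ hκA (fun m Y => hA n U hU m Y) (fun m Y => hB n U hU m Y) Z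

omit [Fintype Γ] [DecidableEq Γ] in
/-- **Replica-stable version**: `IsGramBoundedR A κ_A → IsGramBoundedR B κ_B → IsGramBoundedR (A + B) (κ_A + κ_B)`. [cite: BenfattoGiulianiMastropietro2006, (2.80)] -/
theorem IsGramBoundedR.add {A B : Matrix Γ Γ 𝕜} {κA κB : ℝ} (hA : IsGramBoundedR A κA) (hB : IsGramBoundedR B κB)
    (hκA : 0 ≤ κA) : IsGramBoundedR (A + B) (κA + κB) := by
  intro Γ' _ _ e
  rw [Matrix.submatrix_add]
  exact (hA e).add (hB e) hκA

end Add

/-! ### §4 Negation (over `ℂ`: the substitution `ψ ↦ iψ`) and subtraction -/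

section Neg

variable {Γ : Type u} [Fintype Γ] [DecidableEq Γ]

/-- `|∫ dμ_{−C} ψ(Z)| = |∫ dμ_C ψ(Z)|` (rescale every field by `i`: the covariance changes sign, the string by `i^{|Z|}`).
[cite: Salmhofer1999, App. B.2 (B.23)-(B.25)] -/
theorem norm_gaussExpect_genProd_neg (C : Matrix Γ Γ ℂ) {N : ℕ} (Z : Fin N → Γ) :
    ‖gaussExpect ℂ (-C) (genProd ℂ Z)‖ = ‖gaussExpect ℂ C (genProd ℂ Z)‖ := by
  -- the substitution `ψ ↦ i ψ`
  have hmap : ∀ {m : ℕ} (Y : Fin m → Γ), ExteriorAlgebra.map (LinearMap.mulLeft ℂ (fun _ : Γ => Complex.I)) (genProd ℂ Y) =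
      Complex.I ^ m • genProd ℂ Y := by
    intro m Y
    induction m with
    | zero => simp [genProd]
    | succ m ih => rw [genProd_succ, map_mul, map_mulLeft_gen, ih (Fin.tail Y), smul_mul_smul_comm, pow_succ']
  have hcov : (LinearMap.toMatrix' (LinearMap.mulLeft ℂ (fun _ : Γ => Complex.I))).transpose * (-C) *
      LinearMap.toMatrix' (LinearMap.mulLeft ℂ (fun _ : Γ => Complex.I)) = C := by
    rw [toMatrix'_mulLeft, diagonal_transpose_mul_mul_diagonal]
    ext X Y
    simp [Matrix.neg_apply]
  have h := gaussConv_map ℂ (LinearMap.mulLeft ℂ (fun _ : Γ => Complex.I)) (-C) (genProd ℂ Z)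
  rw [hcov, hmap, map_smul] at h
  have h2 := congrArg (constPart ℂ) h
  rw [map_smul, constPart_map, ← gaussExpect_apply, ← gaussExpect_apply, smul_eq_mul] at h2
  have hI : ‖Complex.I ^ N‖ = 1 := by rw [norm_pow, Complex.norm_I, one_pow]
  have h3 := congrArg (fun z => ‖z‖) h2
  simp only [norm_mul, hI, one_mul] at h3
  exact h3

/-- **`IsGramBounded (−C) κ`** from `IsGramBounded C κ` (over `ℂ`). [cite: BenfattoGiulianiMastropietro2006, (2.80)] -/
theorem IsGramBounded.neg {C : Matrix Γ Γ ℂ} {κ : ℝ} (h : IsGramBounded C κ) : IsGramBounded (-C) κ := by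
  intro n U hU N Z
  have hw : gramWeighted U (-C) = -gramWeighted U C := by
    ext X Y
    simp [gramWeighted_apply, Matrix.neg_apply]
  rw [hw, norm_gaussExpect_genProd_neg]
  exact h n U hU N Z

omit [Fintype Γ] [DecidableEq Γ] in
/-- **`IsGramBoundedR (−C) κ`** (over `ℂ`). [cite: BenfattoGiulianiMastropietro2006, (2.80)] -/
theorem IsGramBoundedR.neg {C : Matrix Γ Γ ℂ} {κ : ℝ} (h : IsGramBoundedR C κ) : IsGramBoundedR (-C) κ := by
  intro Γ' _ _ e
  rw [Matrix.submatrix_neg]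
  exact (h e).neg

omit [Fintype Γ] [DecidableEq Γ] in
/-- **`IsGramBoundedR (A − B) (κ_A + κ_B)`** (over `ℂ`; e.g. the two-volume defect `C′ − C^cop`). [cite: BenfattoGiulianiMastropietro2006, (2.80)] -/
theorem IsGramBoundedR.sub {A B : Matrix Γ Γ ℂ} {κA κB : ℝ} (hA : IsGramBoundedR A κA) (hB : IsGramBoundedR B κB)
    (hκA : 0 ≤ κA) : IsGramBoundedR (A - B) (κA + κB) := by
  rw [sub_eq_add_neg]
  exact hA.add hB.neg hκA

end Neg

end Literature.MathematicalPhysics.QuantumLattice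

end
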